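import Summits.CriticalPhenomena.PercolationContinuityZ3.Theorems.PercNearOneGluingNoHeavyLowerTailGluedSetExchange
import HarnessLib

/-!
# `NoHeavyLowerTail` (stmt-CriticalPhenomena-4575) — SELF-GLUING DOMINANCE for an arbitrary observer and any coin (TOP'')

Support file (prover `prim-hp-8`, PL programme / coin reduction; `--supports stmt-CriticalPhenomena-4575`).
No definitions, no named facts, no sorries.

Weights `v`, relays `A`, level `j`, an observer `o` (its other edges — to relays or to free vertices — arbitrary), a vertex
`c ≠ o` with `v s(o,c) = 0`, `H` = the weights with the pairs at `o` switched off, `loss(y) := μ_v(R_y) − μ_{v[oc ↦ 1]}(R_y)` = the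
lightness lost by `y` when `o` is glued onto `c`.

* `selfGluingLoss_ge_of_exchange` — `PatternLightestStar.selfGluingLoss_ge` with its passenger-transfer hypothesis replaced by
  the exchange inequality of `CoinReduction.gluedSet_exchange` (that proof verbatim).
* `selfGluingLoss_ge_general` (**TOP''**) — for every `x ≠ o` with `μ_H(R_x) ≤ μ_H(R_c)`:  `loss(x) ≤ loss(c)`
  ("gluing the observer onto `c` costs `c` at least as much lightness as it costs any relay that is no more light-prone than `c`
  in `H`").  No hypothesis on the other neighbours of `o`.  Proof: the two losses are affine in each other non-loop weight at
  `o`, so it suffices to treat deterministic weights at `o` (induction on the number of fractional ones, as in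
  `selfGluingLoss_ge_star`); there `gluedSet_exchange` + `selfGluingLoss_ge_of_exchange`.
  `PatternLightestStar.selfGluingLoss_ge_star` is the special case "every other neighbour of `o` is a relay dominated by `c`".

This is the cross-term ingredient of the coin reduction of the pattern-lightest bound (memo PROOF-COIN-REDUCTION.md on the item):
with it, the one-bond expansion of the PL functional in a coin has a nonnegative cross term for EVERY coin of EVERY observer.
-/

noncomputable section

namespace Summit.CriticalPhenomena.PercolationContinuityZ3.Theorems

namespace CoinReduction

open MeasureTheory Set Literature.Probability.LatticeModels Literature.Probability.Percolation
open scoped Classical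

variable {n : ℕ}

/-- **Self-gluing loss domination, exchange form.**  `PatternLightestStar.selfGluingLoss_ge` with its passenger-transfer
hypothesis replaced by the exchange inequality `μ_v(D ∩ (R_o ∩ R_pᶜ ∩ {o ↔ x})) ≤ μ_v(D ∩ (R_p ∩ R_oᶜ ∩ {o ↔ x}))`, `D = {o ↮ p}`
(the conclusion of `gluedSet_exchange`): if `v s(o,p) = 0` then gluing `o` onto `p` costs `x` at most as much lightness as it
costs `p`, `loss(x) ≤ loss(p)` with `loss(y) = μ_v(R_y) − μ_{v[op ↦ 1]}(R_y)`.  Proof = that proof verbatim (pointwise comparison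
of the two losses, then the exchange inequality on the one remaining pair of events). [folklore] -/
theorem selfGluingLoss_ge_of_exchange (v : Sym2 (Fin n) → unitInterval) (A : Finset (Fin n)) (j : ℕ) {o p : Fin n}
    (hop : o ≠ p) (hv : v s(o, p) = 0) (x : Fin n)
    (hQ : (prodBernoulli v).real ((openConn o p)ᶜ ∩
        ({ω : BondConfig (Fin n) | (A.filter fun z => ω ∈ openConn o z).card ≤ j} ∩
          {ω : BondConfig (Fin n) | (A.filter fun z => ω ∈ openConn p z).card ≤ j}ᶜ ∩ openConn o x)) ≤
      (prodBernoulli v).real ((openConn o p)ᶜ ∩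
        ({ω : BondConfig (Fin n) | (A.filter fun z => ω ∈ openConn p z).card ≤ j} ∩
          {ω : BondConfig (Fin n) | (A.filter fun z => ω ∈ openConn o z).card ≤ j}ᶜ ∩ openConn o x))) :
    (prodBernoulli v).real {ω : BondConfig (Fin n) | (A.filter fun z => ω ∈ openConn x z).card ≤ j} -
        (prodBernoulli (Function.update v s(o, p) 1)).real
          {ω : BondConfig (Fin n) | (A.filter fun z => ω ∈ openConn x z).card ≤ j} ≤
      (prodBernoulli v).real {ω : BondConfig (Fin n) | (A.filter fun z => ω ∈ openConn p z).card ≤ j} -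
        (prodBernoulli (Function.update v s(o, p) 1)).real
          {ω : BondConfig (Fin n) | (A.filter fun z => ω ∈ openConn p z).card ≤ j} := by
  set μ := prodBernoulli v with hμ
  -- blocks and events
  set Bp : BondConfig (Fin n) → Finset (Fin n) := fun ω => A.filter fun z => ω ∈ openConn p z with hBp
  set Bo : BondConfig (Fin n) → Finset (Fin n) := fun ω => A.filter fun z => ω ∈ openConn o z with hBo
  set Bx : BondConfig (Fin n) → Finset (Fin n) := fun ω => A.filter fun z => ω ∈ openConn x z with hBx
  set Rp : Set (BondConfig (Fin n)) := {ω | (Bp ω).card ≤ j} with hRp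
  set Ro : Set (BondConfig (Fin n)) := {ω | (Bo ω).card ≤ j} with hRo
  set Rx : Set (BondConfig (Fin n)) := {ω | (Bx ω).card ≤ j} with hRx
  set D : Set (BondConfig (Fin n)) := (openConn o p)ᶜ with hD
  set E : Set (BondConfig (Fin n)) := openConn o x with hE
  set Rp' : Set (BondConfig (Fin n)) := {ω | (Bp ω ∪ Bo ω).card ≤ j} with hRp'
  set K1 : Set (BondConfig (Fin n)) := Rp ∩ Rp'ᶜ with hK1
  set K3 : Set (BondConfig (Fin n)) := Ro ∩ Rp'ᶜ with hK3
  set Xp : Set (BondConfig (Fin n)) := openConn x p with hXp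
  set Xo : Set (BondConfig (Fin n)) := openConn x o with hXo
  have hmeas : ∀ S : Set (BondConfig (Fin n)), MeasurableSet S := fun S => (Set.toFinite S).measurableSet
  have hfin : ∀ S : Set (BondConfig (Fin n)), μ S ≠ ⊤ := fun S => measure_ne_top _ _
  -- the glued measure as a preimage
  have hglue : ∀ S : Set (BondConfig (Fin n)), (prodBernoulli (Function.update v s(o, p) 1)).real S =
      μ.real ((fun ω : BondConfig (Fin n) => insert s(o, p) ω) ⁻¹' S) :=
    fun S => ChampionStability.real_update_one_eq v hv S
  -- (1) the loss of p is exactly μ(K1)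
  have hpre_p : (fun ω : BondConfig (Fin n) => insert s(o, p) ω) ⁻¹'
      {ω : BondConfig (Fin n) | (A.filter fun z => ω ∈ openConn p z).card ≤ j} = Rp' := by
    ext ω
    simp only [mem_preimage, mem_setOf_eq, hRp']
    rw [PatternLightestStar.filter_insert_self ω A hop]
  have hRp'sub : Rp' ⊆ Rp := by
    intro ω hω
    simp only [hRp', hRp, mem_setOf_eq] at hω ⊢
    exact le_trans (Finset.card_le_card Finset.subset_union_left) hω
  have hkap : μ.real {ω : BondConfig (Fin n) | (A.filter fun z => ω ∈ openConn p z).card ≤ j} -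
      (prodBernoulli (Function.update v s(o, p) 1)).real
        {ω : BondConfig (Fin n) | (A.filter fun z => ω ∈ openConn p z).card ≤ j} = μ.real K1 := by
    rw [hglue, hpre_p]
    change μ.real Rp - μ.real Rp' = μ.real (Rp ∩ Rp'ᶜ)
    have h := measureReal_inter_add_sdiff (μ := μ) (s := Rp) (hmeas Rp')
    rw [inter_eq_right.2 hRp'sub] at h
    rw [← h, Set.sdiff_eq]
    ring
  -- (2) the loss of x is at most μ(K1 ∩ Xp) + μ(K3 ∩ Xo ∩ Xpᶜ)
  have hsubx : {ω : BondConfig (Fin n) | (A.filter fun z => ω ∈ openConn x z).card ≤ j} ⊆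
      (fun ω : BondConfig (Fin n) => insert s(o, p) ω) ⁻¹'
          {ω : BondConfig (Fin n) | (A.filter fun z => ω ∈ openConn x z).card ≤ j} ∪
        ((K1 ∩ Xp) ∪ (K3 ∩ Xo ∩ Xpᶜ)) := by
    intro ω hω
    simp only [mem_setOf_eq] at hω
    by_cases hxp : (openGraph ω).Reachable x p
    · -- x joined to p: blocks of x and p coincide
      by_cases hlight : (Bp ω ∪ Bo ω).card ≤ j
      · left
        simp only [mem_preimage, mem_setOf_eq]
        refine le_trans (Finset.card_le_card ((PatternLightestStar.filter_insert_passenger_subset ω A x hop).trans ?_)) hlight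
        intro z hz
        simp only [Finset.mem_union] at hz ⊢
        rcases hz with h | h | h
        · left
          simp only [hBp, Finset.mem_filter] at h ⊢
          exact ⟨h.1, (hxp.symm.trans h.2 : (openGraph ω).Reachable p z)⟩
        · exact Or.inl h
        · exact Or.inr h
      · right; left
        refine ⟨⟨?_, hlight⟩, hxp⟩
        simp only [hRp, mem_setOf_eq]
        have : Bp ω = Bx ω := by
          simp only [hBp, hBx]
          apply Finset.filter_congr
          intro z _
          exact ⟨fun h => (hxp.trans h : (openGraph ω).Reachable x z),
            fun h => (hxp.symm.trans h : (openGraph ω).Reachable p z)⟩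
        rw [this]; exact hω
    · by_cases hxo : (openGraph ω).Reachable x o
      · by_cases hlight : (Bp ω ∪ Bo ω).card ≤ j
        · left
          simp only [mem_preimage, mem_setOf_eq]
          refine le_trans (Finset.card_le_card ((PatternLightestStar.filter_insert_passenger_subset ω A x hop).trans ?_)) hlight
          intro z hz
          simp only [Finset.mem_union] at hz ⊢
          rcases hz with h | h | h
          · right
            simp only [hBo, Finset.mem_filter] at h ⊢
            exact ⟨h.1, (hxo.symm.trans h.2 : (openGraph ω).Reachable o z)⟩
          · exact Or.inl h
          · exact Or.inr h
        · right; right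
          refine ⟨⟨⟨?_, hlight⟩, hxo⟩, hxp⟩
          simp only [hRo, mem_setOf_eq]
          have : Bo ω = Bx ω := by
            simp only [hBo, hBx]
            apply Finset.filter_congr
            intro z _
            exact ⟨fun h => (hxo.trans h : (openGraph ω).Reachable x z),
              fun h => (hxo.symm.trans h : (openGraph ω).Reachable o z)⟩
          rw [this]; exact hω
      · left
        simp only [mem_preimage, mem_setOf_eq]
        rw [PatternLightestStar.filter_insert_passenger_of_not ω A hop hxo hxp]
        exact hω
  have hlam : μ.real {ω : BondConfig (Fin n) | (A.filter fun z => ω ∈ openConn x z).card ≤ j} -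
      (prodBernoulli (Function.update v s(o, p) 1)).real
        {ω : BondConfig (Fin n) | (A.filter fun z => ω ∈ openConn x z).card ≤ j} ≤
      μ.real (K1 ∩ Xp) + μ.real (K3 ∩ Xo ∩ Xpᶜ) := by
    rw [hglue]
    have h1 := measureReal_mono (μ := μ) hsubx (hfin _)
    have h2 := measureReal_union_le (μ := μ)
      ((fun ω : BondConfig (Fin n) => insert s(o, p) ω) ⁻¹'
          {ω : BondConfig (Fin n) | (A.filter fun z => ω ∈ openConn x z).card ≤ j})
      ((K1 ∩ Xp) ∪ (K3 ∩ Xo ∩ Xpᶜ))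
    have h3 := measureReal_union_le (μ := μ) (K1 ∩ Xp) (K3 ∩ Xo ∩ Xpᶜ)
    linarith
  -- (3) μ(K1) = μ(K1 ∩ Xp) + μ(K1 ∩ Xpᶜ)
  have hK1split : μ.real K1 = μ.real (K1 ∩ Xp) + μ.real (K1 ∩ Xpᶜ) := by
    rw [← measureReal_inter_add_sdiff (μ := μ) (s := K1) (hmeas Xp), Set.sdiff_eq]
  -- (4) split the remaining terms along Ro / Rp
  have hK1' : μ.real (K1 ∩ Xpᶜ) = μ.real (K1 ∩ Xpᶜ ∩ Ro) + μ.real (K1 ∩ Xpᶜ ∩ Roᶜ) := by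
    rw [← measureReal_inter_add_sdiff (μ := μ) (s := K1 ∩ Xpᶜ) (hmeas Ro), Set.sdiff_eq]
  have hK3' : μ.real (K3 ∩ Xo ∩ Xpᶜ) = μ.real (K3 ∩ Xo ∩ Xpᶜ ∩ Rp) + μ.real (K3 ∩ Xo ∩ Xpᶜ ∩ Rpᶜ) := by
    rw [← measureReal_inter_add_sdiff (μ := μ) (s := K3 ∩ Xo ∩ Xpᶜ) (hmeas Rp), Set.sdiff_eq]
  -- (4a) both-light parts: K3 ∩ Xo ∩ Xpᶜ ∩ Rp ⊆ K1 ∩ Xpᶜ ∩ Ro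
  have h4a : μ.real (K3 ∩ Xo ∩ Xpᶜ ∩ Rp) ≤ μ.real (K1 ∩ Xpᶜ ∩ Ro) := by
    apply measureReal_mono _ (hfin _)
    rintro ω ⟨⟨⟨⟨hRo', hRp'c⟩, _⟩, hxp⟩, hRpω⟩
    exact ⟨⟨⟨hRpω, hRp'c⟩, hxp⟩, hRo'⟩
  -- (4b) the exchange part: K3 ∩ Xo ∩ Xpᶜ ∩ Rpᶜ ⊆ D ∩ (Ro ∩ Rpᶜ ∩ E) and D ∩ (Rp ∩ Roᶜ ∩ E) ⊆ K1 ∩ Xpᶜ ∩ Roᶜ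
  have hDof : ∀ ω : BondConfig (Fin n), ω ∉ Rp' → ω ∈ Ro → ω ∈ D := by
    intro ω h1 h2 hop'
    apply h1
    simp only [hRp', mem_setOf_eq]
    have hsub : Bp ω ∪ Bo ω ⊆ Bo ω := by
      intro z hz
      simp only [Finset.mem_union] at hz
      rcases hz with h | h
      · simp only [hBp, hBo, Finset.mem_filter] at h ⊢
        have hop'' : (openGraph ω).Reachable o p := hop'
        exact ⟨h.1, (hop''.trans h.2 : (openGraph ω).Reachable o z)⟩
      · exact h
    exact le_trans (Finset.card_le_card hsub) h2
  have hDof' : ∀ ω : BondConfig (Fin n), ω ∉ Rp' → ω ∈ Rp → ω ∈ D := by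
    intro ω h1 h2 hop'
    apply h1
    simp only [hRp', mem_setOf_eq]
    have hsub : Bp ω ∪ Bo ω ⊆ Bp ω := by
      intro z hz
      simp only [Finset.mem_union] at hz
      rcases hz with h | h
      · exact h
      · simp only [hBp, hBo, Finset.mem_filter] at h ⊢
        have hop'' : (openGraph ω).Reachable o p := hop'
        exact ⟨h.1, (hop''.symm.trans h.2 : (openGraph ω).Reachable p z)⟩
    exact le_trans (Finset.card_le_card hsub) h2
  have h4b1 : μ.real (K3 ∩ Xo ∩ Xpᶜ ∩ Rpᶜ) ≤ μ.real (D ∩ (Ro ∩ Rpᶜ ∩ E)) := by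
    apply measureReal_mono _ (hfin _)
    rintro ω ⟨⟨⟨⟨hRo', hRp'c⟩, hxo⟩, _⟩, hRpc⟩
    refine ⟨hDof ω hRp'c hRo', ⟨hRo', hRpc⟩, ?_⟩
    have hxo' : (openGraph ω).Reachable x o := hxo
    exact (hxo'.symm : (openGraph ω).Reachable o x)
  have h4b3 : μ.real (D ∩ (Rp ∩ Roᶜ ∩ E)) ≤ μ.real (K1 ∩ Xpᶜ ∩ Roᶜ) := by
    apply measureReal_mono _ (hfin _)
    rintro ω ⟨hDω, ⟨hRpω, hRoc⟩, hE'⟩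
    have hRp'c : ω ∉ Rp' := by
      intro h'
      apply hRoc
      simp only [hRp', hRo, mem_setOf_eq] at h' ⊢
      exact le_trans (Finset.card_le_card Finset.subset_union_right) h'
    refine ⟨⟨⟨hRpω, hRp'c⟩, ?_⟩, hRoc⟩
    intro hxp
    apply hDω
    have hE'' : (openGraph ω).Reachable o x := hE'
    have hxp' : (openGraph ω).Reachable x p := hxp
    exact (hE''.trans hxp' : (openGraph ω).Reachable o p)
  -- the passenger lonely transfer
  have hpass : μ.real (D ∩ (Ro ∩ Rpᶜ ∩ E)) ≤ μ.real (D ∩ (Rp ∩ Roᶜ ∩ E)) := hQ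
  -- assemble
  have hkap' := hkap
  rw [hkap]
  calc μ.real {ω : BondConfig (Fin n) | (A.filter fun z => ω ∈ openConn x z).card ≤ j} -
        (prodBernoulli (Function.update v s(o, p) 1)).real
          {ω : BondConfig (Fin n) | (A.filter fun z => ω ∈ openConn x z).card ≤ j}
      ≤ μ.real (K1 ∩ Xp) + μ.real (K3 ∩ Xo ∩ Xpᶜ) := hlam
    _ = μ.real (K1 ∩ Xp) + (μ.real (K3 ∩ Xo ∩ Xpᶜ ∩ Rp) + μ.real (K3 ∩ Xo ∩ Xpᶜ ∩ Rpᶜ)) := by rw [hK3']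
    _ ≤ μ.real (K1 ∩ Xp) + (μ.real (K1 ∩ Xpᶜ ∩ Ro) + μ.real (D ∩ (Ro ∩ Rpᶜ ∩ E))) := by linarith [h4a, h4b1]
    _ ≤ μ.real (K1 ∩ Xp) + (μ.real (K1 ∩ Xpᶜ ∩ Ro) + μ.real (D ∩ (Rp ∩ Roᶜ ∩ E))) := by linarith [hpass]
    _ ≤ μ.real (K1 ∩ Xp) + (μ.real (K1 ∩ Xpᶜ ∩ Ro) + μ.real (K1 ∩ Xpᶜ ∩ Roᶜ)) := by linarith [h4b3]
    _ = μ.real K1 := by rw [← hK1', ← hK1split]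

/-- **Self-gluing dominance for an arbitrary observer and any coin (TOP'').**  `c ≠ o`, `v s(o,c) = 0`, `x ≠ o`, and
`μ_H(R_x) ≤ μ_H(R_c)` in the graph `H` with the pairs at `o` switched off.  Then
`μ_v(R_x) − μ_{v[oc↦1]}(R_x) ≤ μ_v(R_c) − μ_{v[oc↦1]}(R_c)`.  The other edges at `o` are unrestricted (relays or free vertices, any
weights). [folklore — via `gluedSet_exchange` (BHK 1.5)] -/
theorem selfGluingLoss_ge_general (v : Sym2 (Fin n) → unitInterval) (A : Finset (Fin n)) (j : ℕ) {o c : Fin n}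
    (hco : c ≠ o) (hvc : v s(o, c) = 0) {x : Fin n} (hxo : x ≠ o)
    (hle : (prodBernoulli fun e : Sym2 (Fin n) => if e ∈ {e : Sym2 (Fin n) | o ∉ e} then v e else 0).real
        {ω : BondConfig (Fin n) | (A.filter fun z => ω ∈ openConn x z).card ≤ j} ≤
      (prodBernoulli fun e : Sym2 (Fin n) => if e ∈ {e : Sym2 (Fin n) | o ∉ e} then v e else 0).real
        {ω : BondConfig (Fin n) | (A.filter fun z => ω ∈ openConn c z).card ≤ j}) :
    (prodBernoulli v).real {ω : BondConfig (Fin n) | (A.filter fun z => ω ∈ openConn x z).card ≤ j} -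
        (prodBernoulli (Function.update v s(o, c) 1)).real
          {ω : BondConfig (Fin n) | (A.filter fun z => ω ∈ openConn x z).card ≤ j} ≤
      (prodBernoulli v).real {ω : BondConfig (Fin n) | (A.filter fun z => ω ∈ openConn c z).card ≤ j} -
        (prodBernoulli (Function.update v s(o, c) 1)).real
          {ω : BondConfig (Fin n) | (A.filter fun z => ω ∈ openConn c z).card ≤ j} := by
  have hoc : o ≠ c := fun h => hco h.symm
  suffices H : ∀ (k : ℕ) (v : Sym2 (Fin n) → unitInterval),
      (Finset.univ.filter fun y : Fin n => y ≠ o ∧ v s(o, y) ≠ 0 ∧ v s(o, y) ≠ 1).card = k → v s(o, c) = 0 →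
      (prodBernoulli fun e : Sym2 (Fin n) => if e ∈ {e : Sym2 (Fin n) | o ∉ e} then v e else 0).real
          {ω : BondConfig (Fin n) | (A.filter fun z => ω ∈ openConn x z).card ≤ j} ≤
        (prodBernoulli fun e : Sym2 (Fin n) => if e ∈ {e : Sym2 (Fin n) | o ∉ e} then v e else 0).real
          {ω : BondConfig (Fin n) | (A.filter fun z => ω ∈ openConn c z).card ≤ j} →
      (prodBernoulli v).real {ω : BondConfig (Fin n) | (A.filter fun z => ω ∈ openConn x z).card ≤ j} -
          (prodBernoulli (Function.update v s(o, c) 1)).real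
            {ω : BondConfig (Fin n) | (A.filter fun z => ω ∈ openConn x z).card ≤ j} ≤
        (prodBernoulli v).real {ω : BondConfig (Fin n) | (A.filter fun z => ω ∈ openConn c z).card ≤ j} -
          (prodBernoulli (Function.update v s(o, c) 1)).real
            {ω : BondConfig (Fin n) | (A.filter fun z => ω ∈ openConn c z).card ≤ j} from
    H _ v rfl hvc hle
  intro k
  induction k using Nat.strong_induction_on with
  | _ k ih =>
  intro v hk hv hlev
  set Rx : Set (BondConfig (Fin n)) := {ω | (A.filter fun z => ω ∈ openConn x z).card ≤ j} with hRx
  set Rc : Set (BondConfig (Fin n)) := {ω | (A.filter fun z => ω ∈ openConn c z).card ≤ j} with hRc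
  by_cases hfrac : ∃ y : Fin n, y ≠ o ∧ v s(o, y) ≠ 0 ∧ v s(o, y) ≠ 1
  · -- push the fractional weight at s(o,y) to 0 and to 1
    obtain ⟨y, hyo, hy0, hy1⟩ := hfrac
    set f : Sym2 (Fin n) := s(o, y) with hf
    have hfe : f ≠ s(o, c) := by
      intro h
      apply hy0
      rw [h]; exact hv
    -- the restricted weights do not change
    have hu : ∀ t : unitInterval, (fun e : Sym2 (Fin n) => if e ∈ {e : Sym2 (Fin n) | o ∉ e} then
        Function.update v f t e else 0) =
        fun e : Sym2 (Fin n) => if e ∈ {e : Sym2 (Fin n) | o ∉ e} then v e else 0 := by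
      intro t
      funext e
      by_cases he : e ∈ {e : Sym2 (Fin n) | o ∉ e}
      · have hef : e ≠ f := by
          intro h'; apply he; rw [h', hf]; exact Sym2.mem_mk_left o y
        simp only [he, if_true, Function.update_of_ne hef]
      · simp only [he, if_false]
    have hcount : ∀ t : unitInterval, (t = 0 ∨ t = 1) →
        (Finset.univ.filter fun z : Fin n => z ≠ o ∧ Function.update v f t s(o, z) ≠ 0 ∧
          Function.update v f t s(o, z) ≠ 1).card < k := by
      intro t ht
      rw [← hk]
      apply Finset.card_lt_card
      rw [Finset.ssubset_iff_of_subset]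
      · refine ⟨y, Finset.mem_filter.2 ⟨Finset.mem_univ _, hyo, hy0, hy1⟩, ?_⟩
        intro h
        have h' := (Finset.mem_filter.1 h).2.2
        rw [← hf, Function.update_self] at h'
        rcases ht with ht | ht
        · exact h'.1 ht
        · exact h'.2 ht
      · intro z hz
        have hz' := (Finset.mem_filter.1 hz).2
        refine Finset.mem_filter.2 ⟨Finset.mem_univ _, hz'.1, ?_⟩
        by_cases hzf : s(o, z) = f
        · rw [hzf, Function.update_self] at hz'
          rcases ht with ht | ht
          · exact absurd ht hz'.2.1
          · exact absurd ht hz'.2.2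
        · have h2 := hz'.2
          rwa [Function.update_of_ne hzf] at h2
    have hvt : ∀ t : unitInterval, Function.update v f t s(o, c) = 0 := by
      intro t; rw [Function.update_of_ne (Ne.symm hfe)]; exact hv
    have hlet : ∀ t : unitInterval,
        (prodBernoulli fun e : Sym2 (Fin n) => if e ∈ {e : Sym2 (Fin n) | o ∉ e} then
            Function.update v f t e else 0).real Rx ≤
        (prodBernoulli fun e : Sym2 (Fin n) => if e ∈ {e : Sym2 (Fin n) | o ∉ e} then
            Function.update v f t e else 0).real Rc := by
      intro t; rw [hu t]; exact hlev
    have ih0 := ih _ (hcount 0 (Or.inl rfl)) (Function.update v f 0) rfl (hvt 0) (hlet 0)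
    have ih1 := ih _ (hcount 1 (Or.inr rfl)) (Function.update v f 1) rfl (hvt 1) (hlet 1)
    -- affinity in the weight of f
    have hcomm : ∀ t : unitInterval, Function.update (Function.update v f t) s(o, c) 1 =
        Function.update (Function.update v s(o, c) 1) f t := fun t => Function.update_comm hfe _ _ _
    rw [hcomm 0] at ih0
    rw [hcomm 1] at ih1
    have e1 := TieLocus.real_oneBond v f Rx
    have e2 := TieLocus.real_oneBond v f Rc
    have e3 := TieLocus.real_oneBond (Function.update v s(o, c) 1) f Rx
    have e4 := TieLocus.real_oneBond (Function.update v s(o, c) 1) f Rc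
    have hvf : (Function.update v s(o, c) 1) f = v f := Function.update_of_ne hfe _ _
    rw [hvf] at e3 e4
    have h0 : 0 ≤ (v f : ℝ) := (v f).2.1
    have h1 : (v f : ℝ) ≤ 1 := (v f).2.2
    rw [e1, e2, e3, e4]
    nlinarith [mul_nonneg (sub_nonneg.2 h1) (sub_nonneg.2 ih0), mul_nonneg h0 (sub_nonneg.2 ih1)]
  · -- all non-loop weights at o are 0 or 1: exchange through the glued set
    push Not at hfrac
    have hdet : ∀ y : Fin n, y ≠ o → v s(o, y) = 0 ∨ v s(o, y) = 1 := by
      intro y hyo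
      by_cases h : v s(o, y) = 0
      · exact Or.inl h
      · exact Or.inr (hfrac y hyo h)
    exact selfGluingLoss_ge_of_exchange v A j hoc hv x (gluedSet_exchange v A j hco hxo hv hdet hlev)

end CoinReduction

end Summit.CriticalPhenomena.PercolationContinuityZ3.Theorems

end
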